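import Literature.LinearAlgebra.TensorNetworks.QTTLaplace

/-!
# Explicit inverses of the one-dimensional finite-difference Laplace matrices and their
# low-rank QTT representations (Kazeev–Khoromskij, §3)

This file continues `Literature.LinearAlgebra.TensorNetworks.QTTLaplace` (the rank-`3`/`4` QTT
representations of `Δ_DD^{(d)}`, `Δ_DN^{(d)}`, `Δ_ND^{(d)}`, Lem. 2.1–2.2 of the cited paper) with
§3 of the same paper, the INVERSE matrices:

* (PROPOSITION 3.1) closed forms of the inverses of the `N × N` matrices
  `Δ_DD = tridiag(-1, 2, -1)` and `Δ_DN` (last diagonal entry `1`): with indices from `1`,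
  `(Δ_DD)⁻¹(i, j) = i(N + 1 - j)/(N + 1)` and `(Δ_DN)⁻¹(i, j) = i` for `i ≤ j` (symmetric) — the
  Green's functions of the corresponding Sturm–Liouville problems.  Here, with indices from `0`:
  `greenDN N = (min(m,n) + 1)_{m,n}`, `greenND N = (N - max(m,n))_{m,n}` (the mirror image
  `m ↦ N - 1 - m` needed for `Δ_ND`, first diagonal entry `1`, which the cited Proposition does not
  print but Thm. 4.1 uses), `greenDD N = ((min(m,n) + 1)(N - max(m,n)))_{m,n}`, and, over any
  commutative ring, `Δ_DN · greenDN = I` (`laplaceDN_mul_greenDN`, `inv_laplaceDN`),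
  `Δ_ND · greenND = I` (`laplaceND_mul_greenND`, `inv_laplaceND`), `Δ_DD · greenDD = (N + 1) I`
  (`laplaceDD_mul_greenDD`; over a field of characteristic zero `inv_laplaceDD :
  (Δ_DD)⁻¹ = (N + 1)⁻¹ greenDD`);
* (LEMMA 3.2) for `d ≥ 2`, `(Δ_DN^{(d)})⁻¹ = [I I₂ J J'] ⋈ C^{⋈(d-2)} ⋈ [E+I₂; 2E; E+I₂+J'; E+I₂+J]`
  with the rank-`4` core `C = [I I₂ J J'; 0 2E 0 0; 0 I₂+J' E 0; 0 I₂+J 0 E]` (blocks of eq. (7):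
  `E = [1 1; 1 1]`): `dnInvCore`, `dnInvTrain` (uniform form `e₀ᵀ ⋈ C^{⋈d} ⋈ (1,1,1,1)ᵀ`, valid for
  every `d ≥ 0`), the automaton `vecMul_chainProd_dnInvCore` (states
  `(𝟙[m=n], min(m,n), 𝟙[m<n], 𝟙[n<m])`), `qttMatrix_dnInvTrain(_eq_inv)`,
  `laplaceDN_mul_qttMatrix_dnInvTrain`, and the three-factor form VERBATIM
  `inv_laplaceDN_eq_dnInvFirst_mul_chainProd_mul_dnInvLast`; the mirror-image rank-`4`
  representation of `(Δ_ND^{(d)})⁻¹` (core `[I I₁ J J'; 0 2E 0 0; 0 I₁+J' E 0; 0 I₁+J 0 E]`, this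
  file's choice; the cited THEOREM 4.1 records the ranks `4 … 4` of `(Δ_ND^{(d)})⁻¹`): `ndInvCore`,
  `ndInvTrain`, `vecMul_chainProd_ndInvCore`, `qttMatrix_ndInvTrain(_eq_inv)`,
  `laplaceND_mul_qttMatrix_ndInvTrain`;
* (LEMMA 3.3) for `d ≥ 2`, `(Δ_DD^{(d)})⁻¹ = W_d ⋈ W_{d-1} ⋈ ⋯ ⋈ W_2 ⋈ W_1` with rank-`5` cores
  depending on the level `k` through `ξ_k = (2^{k-1}+1)/(2^k+1)`, `η_k = 2^{k-2}/(2^k+1)`,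
  `ζ_k = (2^{k-1}+1)/2^{k-1} · ξ_k` and the blocks `P, E, F, K, L` of eq. (7): here `W_k = C_k`
  (`ddInvCore K q`, `q = 2^k`), `W_d = [I Γ_d] = e₀ᵀ ⋈ C_d` (`ddInvFirst`, `vecMul_ddInvCore`),
  `W_1 = [⅓(I+E); 2E; F/18; ⅔K; -⅔L] = C_1 ⋈ H_0` with `H_0 = (½, 1, 0, 0, 0)ᵀ` (`ddInvLast`,
  `ddInvCore_two_mulVec`); the position-dependent train `ddInvTrain` (`e₀ᵀ ⋈ C_d ⋈ ⋯ ⋈ C_1 ⋈ H_0`,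
  valid for every `d ≥ 0`), the column-state recursion `chainProd_ddInvCore_mulVec` (states
  `H_k(m,n) = (G_k(m,n), 2^k, z_m z_n/2^k, z_m + z_n, z_n - z_m)` with `G_k = (Δ_DD^{(k)})⁻¹(m,n)`
  and
  `z_m = 2^k(2m + 1 - 2^k)/(2(2^k + 1))` — this file's rendering of the vectors
  `(Δ^{(k)})⁻¹, 2^k E^{⊗k}, …` spanning the recursion (17)–(20) of the cited proof),
  `qttMatrix_ddInvTrain(_eq_inv)`, `laplaceDD_mul_qttMatrix_ddInvTrain`, and the `d`-factor form
  VERBATIM `inv_laplaceDD_eq_ddInvFirst_mul_chainProd_mul_ddInvLast`.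

CAVEAT ON LEMMA 3.3 (a discrepancy with the printed display, recorded here rather than silently
repaired).  The MPI MIS Preprint 75/2010 prints the cores of Lem. 3.3 (and of Rem. 3.4) with
`Γ_k = [¼ξ_k I + ¼ζ_k P, ξ_k I - ζ_k P, -ξ_k K, ζ_k L]` and with `ξ_kη_k L` as the last entry of the
second row of `V_k`.  With these printed factors the product `W_2 ⋈ W_1` is NOT `(Δ_DD^{(2)})⁻¹`:
its `(0,0)` entry is `3/5`, whereas `(Δ_DD^{(2)})⁻¹(0,0) = 4/5` (exact rational arithmetic; the
mismatch persists for every `d ≥ 2` and under every reading convention — either digit order,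
transposed blocks).  The cores formalised below carry the factors `-½ξ_k K`, `½ζ_k L` in `Γ_k` and
`2ξ_kη_k L` in `V_k` (all other entries, `W_1`, and the constants `ξ_k, η_k, ζ_k` exactly as
printed); with them the representation is exact for every `d` (theorem
`qttMatrix_ddInvTrain_eq_inv`),
so the printed display differs from a correct one by constant factors in three block entries, and
the RANK statement of Lem. 3.3 / Thm. 4.1 (`(Δ_DD^{(d)})⁻¹` has QTT ranks `≤ 5`) is formalised as
stated.  Whether the journal version (SIAM J. Matrix Anal. Appl. 33 (2012)) prints the same
factors has not been checked here.

Conventions: digit pairs most significant first (`quanticsEquiv`), as fixed by Lem. 3.2, whose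
three-factor form is correct only in this reading; indices from `0` (the paper's from `1`); the
level `k` of Lem. 3.3 counts cores from the least significant end (`W_1` last), so the core at
position `ℓ` (from the left, `0 ≤ ℓ < d`) of `ddInvTrain d` is `C_{d-ℓ}`, and the recursion is
read from the right: `TensorTrain.mulVec_chainProd_of_digitStepCons` (if
`H_{k+1}(a·b^k + m, a'·b^k + n) = W_{k+1}(a, a') · H_k(m, n)` then
`W_R(i₁,j₁) ⋯ W_1(i_R,j_R) · H_0(0,0) = H_R(m, n)`), the column-vector companion of
`TensorTrain.vecMul_chainProd_of_digitStep`, with `TensorTrain.chainProd_succ_eq_core_mul` and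
`val_quanticsEquiv_cons`.

Not formalised: the boundary-rank reduction of Rem. 3.4 (ranks `4, 5, …, 5, 4`), minimality of the
ranks (§4), the Neumann and periodic cases, and anything approximate.  Numbering `Prop. 3.1`,
`Lem. 3.2`, `Lem. 3.3`, `Rem. 3.4`, `Thm. 4.1`, `eqs. (7), (17)–(20)` follows the Max Planck
Institute MIS Leipzig Preprint 75/2010 version of [KazeevKhoromskij2012].

References: V. A. Kazeev, B. N. Khoromskij, *Low-rank explicit QTT representation of the Laplace
operator and its inverse*, SIAM J. Matrix Anal. Appl. 33 (2012) 742–758, MPI MIS Preprint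
75/2010 (`KazeevKhoromskij2012`), §3 and Thm. 4.1.

AI-produced formalisation (H21 engines group, seat eng-quad-2, 2026-08-23); no facts, no axioms
beyond Mathlib's, no `sorry`.
-/

open Matrix Finset

namespace Literature.LinearAlgebra.TensorNetworks

universe u

/-! ### The digit recursion read from the least significant end -/

namespace TensorTrain

variable {K : Type u} [CommSemiring K] {b R : ℕ}

/-- Peeling off the FIRST core of a chain of position-dependent cores:
`G₀(s₀) G₁(s₁) ⋯ G_k(s_k) = G₀(s₀) · (G₁(s₁) ⋯ G_k(s_k))`.
[cite: KazeevKhoromskij2012, Rem. 0.6] -/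
theorem chainProd_succ_eq_core_mul {σ : Type*} {n : ℕ} (G : ℕ → σ → Matrix (Fin n) (Fin n) K) :
    ∀ (k : ℕ) (s : Fin (k + 1) → σ),
      chainProd G (k + 1) s = G 0 (s 0) * chainProd (fun ℓ => G (ℓ + 1)) k (Fin.tail s)
  | 0, s => by simp [chainProd]
  | k + 1, s => by
      rw [chainProd, chainProd_succ_eq_core_mul G k (Fin.init s), chainProd, Matrix.mul_assoc]
      rfl

/-- Prepending a most significant digit: `m(a σ₀ … σ_{R-1}) = a · b^R + m(σ)`.
[cite: KazeevKhoromskij2012, eq. (2)] -/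
theorem _root_.Literature.LinearAlgebra.TensorNetworks.val_quanticsEquiv_cons
    (a : Fin b) (σ : Fin R → Fin b) :
    ((quanticsEquiv b (R + 1) (Fin.cons (α := fun _ => Fin b) a σ) : Fin (b ^ (R + 1))) : ℕ) =
      (a : ℕ) * b ^ R + (quanticsEquiv b R σ : ℕ) := by
  rw [val_quanticsEquiv, val_quanticsEquiv, Fin.sum_univ_succ]
  simp only [Fin.cons_zero, Fin.cons_succ, Fin.val_zero, Fin.val_succ]
  congr 1
  refine Finset.sum_congr rfl fun r _ => ?_
  congr 2
  omega

/-- THE DIGIT RECURSION READ FROM THE LEAST SIGNIFICANT END (column-state / transfer-matrix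
form of the recursion `(Δ^{(k)})⁻¹ = I ⊗ (Δ^{(k-1)})⁻¹ + A^{(k)}` of the cited proof): if state
vectors `H k m n ∈ K^r` attached to pairs of `k`-digit numbers obey
`H (k+1) (a b^k + m) (a' b^k + m') = W (k+1) (a, a') · H k m m'` for all digits `a, a'`, then with
the LEVEL-DEPENDENT cores `W d, W (d-1), …, W 1` placed from the most significant digit pair to
the least significant one, `W d (σ₀, μ₀) ⋯ W 1 (σ_{d-1}, μ_{d-1}) · H 0 0 0 = H d m(σ) m(μ)`.
[cite: KazeevKhoromskij2012, Lem. 3.3] -/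
theorem mulVec_chainProd_of_digitStepCons {n : ℕ}
    (W : ℕ → Fin b × Fin b → Matrix (Fin n) (Fin n) K) (H : ℕ → ℕ → ℕ → Fin n → K)
    (hH : ∀ (k m m' : ℕ) (a a' : Fin b), m < b ^ k → m' < b ^ k →
      H (k + 1) (a * b ^ k + m) (a' * b ^ k + m') = W (k + 1) (a, a') *ᵥ H k m m') :
    ∀ (R : ℕ) (σ μ : Fin R → Fin b),
      chainProd (fun ℓ => W (R - ℓ)) R (fun r => (σ r, μ r)) *ᵥ H 0 0 0 =
        H R (quanticsEquiv b R σ) (quanticsEquiv b R μ)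
  | 0, σ, μ => by simp [chainProd]
  | R + 1, σ, μ => by
      have hσ : σ = Fin.cons (α := fun _ => Fin b) (σ 0) (Fin.tail σ) := (Fin.cons_self_tail σ).symm
      have hμ : μ = Fin.cons (α := fun _ => Fin b) (μ 0) (Fin.tail μ) := (Fin.cons_self_tail μ).symm
      rw [chainProd_succ_eq_core_mul, ← Matrix.mulVec_mulVec]
      have ih := mulVec_chainProd_of_digitStepCons W H hH R (Fin.tail σ) (Fin.tail μ)
      have hW : (fun ℓ => W (R + 1 - (ℓ + 1))) = fun ℓ => W (R - ℓ) := by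
        funext ℓ
        rw [Nat.add_sub_add_right]
      have e1 : chainProd (fun ℓ => (fun ℓ' => W (R + 1 - ℓ')) (ℓ + 1)) R
            (Fin.tail fun r => (σ r, μ r)) *ᵥ H 0 0 0 =
          H R (quanticsEquiv b R (Fin.tail σ)) (quanticsEquiv b R (Fin.tail μ)) := by
        rw [← ih, hW]
        rfl
      rw [e1]
      conv_rhs => rw [hσ, hμ]
      rw [val_quanticsEquiv_cons, val_quanticsEquiv_cons, Nat.sub_zero]
      exact (hH R _ _ _ _ (Fin.isLt _) (Fin.isLt _)).symm

end TensorTrain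

/-! ### Proposition 3.1: the inverses in closed form -/

section KazeevKhoromskijInverse

variable (K : Type u) [CommRing K]

/-- `(Δ_DN)⁻¹` of size `N`: the entry `(m, n) ↦ min(m, n) + 1` (indices from `0`; the cited
`min(i, j)` with indices from `1`).  [cite: KazeevKhoromskij2012, Prop. 3.1] -/
def greenDN (N : ℕ) : Matrix (Fin N) (Fin N) K :=
  Matrix.of fun m n => ((min (m : ℕ) n : ℕ) : K) + 1

/-- `(Δ_ND)⁻¹` of size `N`: the entry `(m, n) ↦ N - max(m, n)` (`N - max(i, j) + 1` with indices
from `1`; the mirror image `m ↦ N - 1 - m` of the `Δ_DN` case of the cited Proposition, which prints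
the `Δ_DD` and `Δ_DN` cases).  [cite: KazeevKhoromskij2012, Prop. 3.1] -/
def greenND (N : ℕ) : Matrix (Fin N) (Fin N) K :=
  Matrix.of fun m n => (N : K) - ((max (m : ℕ) n : ℕ) : K)

/-- `(N + 1) · (Δ_DD)⁻¹` of size `N`: the entry `(m, n) ↦ (min(m, n) + 1)(N - max(m, n))` (the
cited `(Δ_DD)⁻¹(i, j) = min(i, j)(N - max(i, j) + 1)/(N + 1)` with indices from `1`, cleared of
its denominator so that it makes sense over any commutative ring).
[cite: KazeevKhoromskij2012, Prop. 3.1] -/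
def greenDD (N : ℕ) : Matrix (Fin N) (Fin N) K :=
  Matrix.of fun m n => (((min (m : ℕ) n : ℕ) : K) + 1) * ((N : K) - ((max (m : ℕ) n : ℕ) : K))

variable {K}

/-- [folklore] A sum over `Fin N` supported at one value of the index (bookkeeping). -/
private theorem sum_ite_val_eq {N : ℕ} (t : ℕ) (g : Fin N → K) :
    (∑ l : Fin N, if (l : ℕ) = t then g l else 0) = if h : t < N then g ⟨t, h⟩ else 0 := by
  split_ifs with h
  · rw [Finset.sum_eq_single ⟨t, h⟩]
    · simp
    · intro l _ hl
      exact if_neg fun e => hl (Fin.ext e)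
    · intro hh
      exact absurd (Finset.mem_univ _) hh
  · exact Finset.sum_eq_zero fun l _ => if_neg fun e : (l : ℕ) = t => h (e ▸ l.isLt)

/-- [folklore] A sum over `Fin N` supported at the predecessor of an index (bookkeeping). -/
private theorem sum_ite_val_succ_eq {N : ℕ} (m : Fin N) (g : Fin N → K) :
    (∑ l : Fin N, if (l : ℕ) + 1 = m then g l else 0) =
      if h : 0 < (m : ℕ) then g ⟨m - 1, by omega⟩ else 0 := by
  split_ifs with h
  · have e : ∀ l : Fin N, ((l : ℕ) + 1 = m) = ((l : ℕ) = m - 1) := fun l => propext (by omega)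
    simp_rw [e]
    rw [sum_ite_val_eq ((m : ℕ) - 1) g, dif_pos (by omega)]
  · have e : ∀ l : Fin N, ¬ ((l : ℕ) + 1 = m) := fun l => by omega
    simp [e]

/-- [folklore] The entries of `T · A` for a matrix `T = tridiag(-1, c, -1)` with an arbitrary
diagonal `c` (bookkeeping: the row `m` of the product is `c_m A_m - A_{m+1} - A_{m-1}` with the
out-of-range rows omitted). -/
private theorem tridiag_mul_apply {N : ℕ} (T A : Matrix (Fin N) (Fin N) K) (c : Fin N → K)
    (hT : ∀ m l : Fin N, T m l =
      if (m : ℕ) = l then c m else if (l : ℕ) = m + 1 ∨ (m : ℕ) = l + 1 then -1 else 0)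
    (m n : Fin N) :
    (T * A) m n = c m * A m n - (if h : (m : ℕ) + 1 < N then A ⟨m + 1, h⟩ n else 0)
      - (if h : 0 < (m : ℕ) then A ⟨m - 1, by omega⟩ n else 0) := by
  have key : ∀ l : Fin N, T m l * A l n =
      (if (l : ℕ) = m then c m * A l n else 0) -
        ((if (l : ℕ) = m + 1 then A l n else 0) + (if (l : ℕ) + 1 = m then A l n else 0)) := by
    intro l
    rw [hT]
    split_ifs <;> first | ring1 | (exfalso; omega)
  rw [Matrix.mul_apply, Finset.sum_congr rfl fun l _ => key l, Finset.sum_sub_distrib,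
    Finset.sum_add_distrib, sum_ite_val_eq ((m : ℕ) + 1) (fun l => A l n),
    sum_ite_val_succ_eq m (fun l => A l n), sum_ite_val_eq (m : ℕ) (fun l => c m * A l n),
    dif_pos m.isLt, sub_sub]

/-- [folklore] The three-term identity behind `Δ_DN · (Δ_DN)⁻¹ = I` (bookkeeping case analysis). -/
private theorem greenDN_aux (N m n : ℕ) (hm : m < N) (hn : n < N) :
    (if m + 1 = N then (1 : K) else 2) * (((min m n : ℕ) : K) + 1)
      - (if m + 1 < N then ((min (m + 1) n : ℕ) : K) + 1 else 0)
      - (if 0 < m then ((min (m - 1) n : ℕ) : K) + 1 else 0)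
      = if m = n then 1 else 0 := by
  have key : m + 1 < N ∨ N = m + 1 := by omega
  rcases key with hN | rfl <;> rcases lt_trichotomy m n with h | h | h <;> rcases m with _ | m <;>
    simp [min_def] <;> (try split_ifs) <;> (try intros)
  all_goals first
    | (exfalso; omega)
    | ring1
    | (subst_vars; ring1)
    | (subst_vars; push_cast; ring1)
    | (obtain rfl : m = n := (by omega); ring1)

/-- [folklore] The three-term identity behind `Δ_ND · (Δ_ND)⁻¹ = I` (bookkeeping case analysis). -/
private theorem greenND_aux (N m n : ℕ) (hm : m < N) (hn : n < N) :
    (if m = 0 then (1 : K) else 2) * ((N : K) - ((max m n : ℕ) : K))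
      - (if m + 1 < N then (N : K) - ((max (m + 1) n : ℕ) : K) else 0)
      - (if 0 < m then (N : K) - ((max (m - 1) n : ℕ) : K) else 0)
      = if m = n then 1 else 0 := by
  have key : m + 1 < N ∨ N = m + 1 := by omega
  rcases key with hN | rfl <;> rcases lt_trichotomy m n with h | h | h <;> rcases m with _ | m <;>
    simp [max_def] <;> (try split_ifs)
  all_goals first
    | (exfalso; omega)
    | ring1
    | (subst_vars; ring1)
    | (subst_vars; push_cast; ring1)
    | (obtain rfl : m = n := (by omega); ring1)

/-- [folklore] The three-term identity behind `Δ_DD · (N+1)(Δ_DD)⁻¹ = (N+1) I` (bookkeeping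
case analysis). -/
private theorem greenDD_aux (N m n : ℕ) (hm : m < N) (hn : n < N) :
    2 * ((((min m n : ℕ) : K) + 1) * ((N : K) - ((max m n : ℕ) : K)))
      - (if m + 1 < N then
          (((min (m + 1) n : ℕ) : K) + 1) * ((N : K) - ((max (m + 1) n : ℕ) : K)) else 0)
      - (if 0 < m then
          (((min (m - 1) n : ℕ) : K) + 1) * ((N : K) - ((max (m - 1) n : ℕ) : K)) else 0)
      = if m = n then (N : K) + 1 else 0 := by
  have key : m + 1 < N ∨ N = m + 1 := by omega
  rcases key with hN | rfl <;> rcases lt_trichotomy m n with h | h | h <;> rcases m with _ | m <;>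
    simp [min_def, max_def] <;> (try split_ifs)
  all_goals first
    | (exfalso; omega)
    | ring1
    | (subst_vars; ring1)
    | (subst_vars; push_cast; ring1)
    | (obtain rfl : m = n := (by omega); ring1)

/-- PROPOSITION 3.1, `Δ_DN`: `Δ_DN · (min(m, n) + 1)_{m,n} = I`.
[cite: KazeevKhoromskij2012, Prop. 3.1] -/
theorem laplaceDN_mul_greenDN (N : ℕ) : laplaceDN K N * greenDN K N = 1 := by
  ext ⟨m, hm⟩ ⟨n, hn⟩
  rw [tridiag_mul_apply (laplaceDN K N) (greenDN K N) (fun m => if (m : ℕ) + 1 = N then 1 else 2)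
    (fun _ _ => rfl)]
  simpa [greenDN, Matrix.one_apply, Fin.ext_iff] using greenDN_aux (K := K) N m n hm hn

/-- PROPOSITION 3.1, `Δ_ND` (mirror image of the printed `Δ_DN` case):
`Δ_ND · (N - max(m, n))_{m,n} = I`.  [cite: KazeevKhoromskij2012, Prop. 3.1] -/
theorem laplaceND_mul_greenND (N : ℕ) : laplaceND K N * greenND K N = 1 := by
  ext ⟨m, hm⟩ ⟨n, hn⟩
  rw [tridiag_mul_apply (laplaceND K N) (greenND K N) (fun m => if (m : ℕ) = 0 then 1 else 2)
    (fun _ _ => rfl)]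
  simpa [greenND, Matrix.one_apply, Fin.ext_iff] using greenND_aux (K := K) N m n hm hn

/-- PROPOSITION 3.1, `Δ_DD`: `Δ_DD · ((min(m, n) + 1)(N - max(m, n)))_{m,n} = (N + 1) I`.
[cite: KazeevKhoromskij2012, Prop. 3.1] -/
theorem laplaceDD_mul_greenDD (N : ℕ) :
    laplaceDD K N * greenDD K N = ((N : K) + 1) • (1 : Matrix (Fin N) (Fin N) K) := by
  ext ⟨m, hm⟩ ⟨n, hn⟩
  rw [tridiag_mul_apply (laplaceDD K N) (greenDD K N) (fun _ => 2) (fun _ _ => rfl)]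
  simpa [greenDD, Matrix.one_apply, Fin.ext_iff] using greenDD_aux (K := K) N m n hm hn

/-- Hence `(Δ_DN)⁻¹ = (min(m, n) + 1)_{m,n}` over any commutative ring.
[cite: KazeevKhoromskij2012, Prop. 3.1] -/
theorem inv_laplaceDN (N : ℕ) : (laplaceDN K N)⁻¹ = greenDN K N :=
  Matrix.inv_eq_right_inv (laplaceDN_mul_greenDN N)

/-- … and `(min(m, n) + 1)_{m,n} · Δ_DN = I`.  [cite: KazeevKhoromskij2012, Prop. 3.1] -/
theorem greenDN_mul_laplaceDN (N : ℕ) : greenDN K N * laplaceDN K N = 1 :=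
  mul_eq_one_comm.1 (laplaceDN_mul_greenDN N)

/-- Hence `(Δ_ND)⁻¹ = (N - max(m, n))_{m,n}` over any commutative ring.
[cite: KazeevKhoromskij2012, Prop. 3.1] -/
theorem inv_laplaceND (N : ℕ) : (laplaceND K N)⁻¹ = greenND K N :=
  Matrix.inv_eq_right_inv (laplaceND_mul_greenND N)

/-- … and `(N - max(m, n))_{m,n} · Δ_ND = I`.  [cite: KazeevKhoromskij2012, Prop. 3.1] -/
theorem greenND_mul_laplaceND (N : ℕ) : greenND K N * laplaceND K N = 1 :=
  mul_eq_one_comm.1 (laplaceND_mul_greenND N)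

/-! ### Lemma 3.2: `(Δ_DN)⁻¹` and `(Δ_ND)⁻¹` have QTT ranks four -/

variable (K)

/-- The middle core `[I I₂ J J'; 0 2E 0 0; 0 I₂+J' E 0; 0 I₂+J 0 E]` of the rank-`4` QTT
representation of `(Δ_DN^{(d)})⁻¹` (`E = [1 1; 1 1]`, i.e. the constant block `1`).
[cite: KazeevKhoromskij2012, Lem. 3.2] -/
def dnInvCore (p : Fin 2 × Fin 2) : Matrix (Fin 4) (Fin 4) K :=
  !![blkI K p, blkI₂ K p, blkJ K p, blkJ' K p; 0, 2, 0, 0; 0, blkI₂ K p + blkJ' K p, 1, 0;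
    0, blkI₂ K p + blkJ K p, 0, 1]

/-- The first core `[I I₂ J J']` of Lem. 3.2 (a `1 × 4` core matrix).
[cite: KazeevKhoromskij2012, Lem. 3.2] -/
def dnInvFirst (p : Fin 2 × Fin 2) : Matrix (Fin 1) (Fin 4) K :=
  !![blkI K p, blkI₂ K p, blkJ K p, blkJ' K p]

/-- The last core `[E+I₂; 2E; E+I₂+J'; E+I₂+J]` of Lem. 3.2 (a `4 × 1` core matrix).
[cite: KazeevKhoromskij2012, Lem. 3.2] -/
def dnInvLast (p : Fin 2 × Fin 2) : Matrix (Fin 4) (Fin 1) K :=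
  !![1 + blkI₂ K p; 2; 1 + blkI₂ K p + blkJ' K p; 1 + blkI₂ K p + blkJ K p]

/-- The rank-`4` train of Lem. 3.2 in uniform form: cores `dnInvCore`, boundary vectors
`(1, 0, 0, 0)` (so that the first core is `[I I₂ J J'] = e₀ᵀ ⋈ C`) and `(1, 1, 1, 1)` (so that the
last core is `[E+I₂; 2E; E+I₂+J'; E+I₂+J] = C ⋈ 𝟙`).  [cite: KazeevKhoromskij2012, Lem. 3.2] -/
def dnInvTrain (d : ℕ) : TensorTrain K (Fin 2 × Fin 2) d :=
  TensorTrain.uniform d 4 (fun _ => dnInvCore K) ![1, 0, 0, 0] ![1, 1, 1, 1]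

/-- States of the `(Δ_DN)⁻¹` automaton after reading the leading digits `m`, `n` of the row and
column index: `(𝟙[m = n], min(m, n), 𝟙[m < n], 𝟙[n < m])`.
[cite: KazeevKhoromskij2012, Lem. 3.2] -/
def dnInvVec (m n : ℕ) : Fin 4 → K :=
  ![if m = n then 1 else 0, ((min m n : ℕ) : K), if m < n then 1 else 0, if n < m then 1 else 0]

/-- The middle core `[I I₁ J J'; 0 2E 0 0; 0 I₁+J' E 0; 0 I₁+J 0 E]` of a rank-`4` QTT
representation of `(Δ_ND^{(d)})⁻¹` (the cited theorem records the ranks; the cores, mirror images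
of those of Lem. 3.2, are this file's choice).  [cite: KazeevKhoromskij2012, Thm. 4.1] -/
def ndInvCore (p : Fin 2 × Fin 2) : Matrix (Fin 4) (Fin 4) K :=
  !![blkI K p, blkI₁ K p, blkJ K p, blkJ' K p; 0, 2, 0, 0; 0, blkI₁ K p + blkJ' K p, 1, 0;
    0, blkI₁ K p + blkJ K p, 0, 1]

/-- The rank-`4` train of `(Δ_ND^{(d)})⁻¹` in uniform form: cores `ndInvCore`, boundary vectors
`(1, 0, 0, 0)` and `(1, 1, 1, 1)`.  [cite: KazeevKhoromskij2012, Thm. 4.1] -/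
def ndInvTrain (d : ℕ) : TensorTrain K (Fin 2 × Fin 2) d :=
  TensorTrain.uniform d 4 (fun _ => ndInvCore K) ![1, 0, 0, 0] ![1, 1, 1, 1]

/-- States of the `(Δ_ND)⁻¹` automaton at level `k`:
`(𝟙[m = n], 2^k - 1 - max(m, n), 𝟙[m < n], 𝟙[n < m])`.  [cite: KazeevKhoromskij2012, Thm. 4.1] -/
def ndInvVec (k m n : ℕ) : Fin 4 → K :=
  ![if m = n then 1 else 0, (2 : K) ^ k - 1 - ((max m n : ℕ) : K), if m < n then 1 else 0,
    if n < m then 1 else 0]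

variable {K}

/-- [folklore] One step of the `(Δ_DN)⁻¹` automaton (bookkeeping case analysis). -/
private theorem dnInvVec_step (m n : ℕ) (a a' : Fin 2) :
    dnInvVec K (2 * m + a) (2 * n + a') = dnInvVec K m n ᵥ* dnInvCore K (a, a') := by
  ext j
  fin_cases a <;> fin_cases a' <;> fin_cases j <;>
    simp [dnInvVec, dnInvCore, blkI, blkJ, blkJ', blkI₂, Matrix.vecMul, dotProduct,
      Fin.sum_univ_four, min_def] <;>
    (try split_ifs) <;> (try intros)
  all_goals first
    | rfl
    | (exfalso; omega)
    | ring1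
    | (obtain rfl : m = n := (by omega); ring1)

/-- [folklore] One step of the `(Δ_ND)⁻¹` automaton (bookkeeping case analysis). -/
private theorem ndInvVec_step (k m n : ℕ) (a a' : Fin 2) :
    ndInvVec K (k + 1) (2 * m + a) (2 * n + a') = ndInvVec K k m n ᵥ* ndInvCore K (a, a') := by
  ext j
  rw [ndInvVec, pow_succ]
  fin_cases a <;> fin_cases a' <;> fin_cases j <;>
    simp [ndInvVec, ndInvCore, blkI, blkJ, blkJ', blkI₁, Matrix.vecMul, dotProduct,
      Fin.sum_univ_four, max_def] <;>
    (try split_ifs) <;> (try intros)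
  all_goals first
    | rfl
    | (exfalso; omega)
    | ring1
    | (obtain rfl : m = n := (by omega); ring1)

/-- The `(Δ_DN)⁻¹` automaton: `(1, 0, 0, 0) · C(σ₀, μ₀) ⋯ C(σ_{d-1}, μ_{d-1}) =
(𝟙[m = n], min(m, n), 𝟙[m < n], 𝟙[n < m])` for `m = m(σ)`, `n = m(μ)`.
[cite: KazeevKhoromskij2012, Lem. 3.2] -/
theorem vecMul_chainProd_dnInvCore (d : ℕ) (σ μ : Fin d → Fin 2) :
    ![(1 : K), 0, 0, 0] ᵥ* TensorTrain.chainProd (fun _ => dnInvCore K) d (fun r => (σ r, μ r)) =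
      dnInvVec K (quanticsEquiv 2 d σ) (quanticsEquiv 2 d μ) := by
  have h0 : dnInvVec K 0 0 = ![1, 0, 0, 0] := by
    ext j; fin_cases j <;> simp [dnInvVec]
  rw [← h0]
  exact TensorTrain.vecMul_chainProd_of_digitStep (dnInvCore K) (fun _ => dnInvVec K)
    (fun _ m m' a a' _ _ => dnInvVec_step m m' a a') d σ μ

/-- [folklore] Output of the `(Δ_DN)⁻¹` automaton (bookkeeping case analysis). -/
private theorem dnInvVec_dotProduct (m n : ℕ) :
    dnInvVec K m n ⬝ᵥ ![1, 1, 1, 1] = ((min m n : ℕ) : K) + 1 := by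
  simp [dnInvVec, dotProduct, Fin.sum_univ_four, min_def]
  split_ifs <;> first | (exfalso; omega) | ring1

/-- LEMMA 3.2: `(Δ_DN^{(d)})⁻¹ = [I I₂ J J'] ⋈ C^{⋈(d-2)} ⋈ [E+I₂; 2E; E+I₂+J'; E+I₂+J]`,
`C = [I I₂ J J'; 0 2E 0 0; 0 I₂+J' E 0; 0 I₂+J 0 E]`, has QTT ranks `4`: the uniform train
represents the matrix `(min(m, n) + 1)_{m,n}` for every `d ≥ 0` …
[cite: KazeevKhoromskij2012, Lem. 3.2] -/
theorem qttMatrix_dnInvTrain (d : ℕ) : (dnInvTrain K d).qttMatrix = greenDN K (2 ^ d) := by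
  rw [TensorTrain.qttMatrix_eq_iff]
  intro σ μ
  rw [dnInvTrain, TensorTrain.eval_uniform, vecMul_chainProd_dnInvCore, greenDN, Matrix.of_apply]
  exact dnInvVec_dotProduct _ _

/-- … which is `(Δ_DN^{(d)})⁻¹` (Prop. 3.1).  [cite: KazeevKhoromskij2012, Lem. 3.2] -/
theorem qttMatrix_dnInvTrain_eq_inv (d : ℕ) :
    (dnInvTrain K d).qttMatrix = (laplaceDN K (2 ^ d))⁻¹ := by
  rw [qttMatrix_dnInvTrain, inv_laplaceDN]

/-- … so that `Δ_DN^{(d)} · (the represented matrix) = I`.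
[cite: KazeevKhoromskij2012, Lem. 3.2] -/
theorem laplaceDN_mul_qttMatrix_dnInvTrain (d : ℕ) :
    laplaceDN K (2 ^ d) * (dnInvTrain K d).qttMatrix = 1 := by
  rw [qttMatrix_dnInvTrain, laplaceDN_mul_greenDN]

/-- [folklore] The entry of `row · M · column` is the bilinear pairing (bookkeeping). -/
private theorem row_mul_mul_col_apply' {n : ℕ} (u v : Fin n → K) (M : Matrix (Fin n) (Fin n) K) :
    (Matrix.of (fun (_ : Fin 1) j => u j) * M * Matrix.of (fun i (_ : Fin 1) => v i)) 0 0 =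
      u ᵥ* M ⬝ᵥ v := by
  simp only [Matrix.mul_apply, Matrix.vecMul, dotProduct, Matrix.of_apply]

/-- [folklore] The first core of Lem. 3.2 is `e₀ᵀ ⋈ C` (bookkeeping). -/
private theorem dnInvFirst_eq (p : Fin 2 × Fin 2) :
    dnInvFirst K p = Matrix.of fun (_ : Fin 1) j => (![(1 : K), 0, 0, 0] ᵥ* dnInvCore K p) j := by
  ext i j
  fin_cases i; fin_cases j <;>
    simp [dnInvFirst, dnInvCore, Matrix.vecMul, dotProduct, Fin.sum_univ_four]

/-- [folklore] The last core of Lem. 3.2 is `C ⋈ (1, 1, 1, 1)ᵀ` (bookkeeping). -/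
private theorem dnInvLast_eq (p : Fin 2 × Fin 2) :
    dnInvLast K p = Matrix.of fun i (_ : Fin 1) => (dnInvCore K p *ᵥ ![(1 : K), 1, 1, 1]) i := by
  obtain ⟨a, a'⟩ := p
  ext i j
  fin_cases j; fin_cases a <;> fin_cases a' <;> fin_cases i <;>
    simp [dnInvLast, dnInvCore, blkI, blkJ, blkJ', blkI₂, Matrix.mulVec, dotProduct,
      Fin.sum_univ_four]

/-- LEMMA 3.2 VERBATIM (`d = k + 2 ≥ 2`): with the row/column digit pairs `(i₁, j₁), …, (i_d, j_d)`
of `(m, n)`, the unique entry of the `1 × 1` matrix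
`[I I₂ J J'](i₁,j₁) · C(i₂,j₂) ⋯ C(i_{d-1},j_{d-1}) · [E+I₂; 2E; E+I₂+J'; E+I₂+J](i_d,j_d)` — the
`((i₁…i_d), (j₁…j_d))` block entry of the strong Kronecker product
`[I I₂ J J'] ⋈ C^{⋈(d-2)} ⋈ [E+I₂; 2E; E+I₂+J'; E+I₂+J]` — is `(Δ_DN^{(d)})⁻¹(m, n)`.
[cite: KazeevKhoromskij2012, Lem. 3.2] -/
theorem inv_laplaceDN_eq_dnInvFirst_mul_chainProd_mul_dnInvLast (k : ℕ)
    (σ μ : Fin (k + 2) → Fin 2) :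
    (dnInvFirst K (σ 0, μ 0) *
        TensorTrain.chainProd (fun _ => dnInvCore K) k
          (fun r : Fin k => (σ r.succ.castSucc, μ r.succ.castSucc)) *
        dnInvLast K (σ (Fin.last (k + 1)), μ (Fin.last (k + 1)))) 0 0 =
      (laplaceDN K (2 ^ (k + 2)))⁻¹ (quanticsEquiv 2 (k + 2) σ) (quanticsEquiv 2 (k + 2) μ) := by
  rw [← qttMatrix_dnInvTrain_eq_inv, TensorTrain.qttMatrix_apply, dnInvTrain,
    TensorTrain.eval_uniform, TensorTrain.chainProd, TensorTrain.chainProd_succ_eq_mul,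
    dnInvFirst_eq, dnInvLast_eq, row_mul_mul_col_apply']
  simp only [← Matrix.vecMul_vecMul, Matrix.dotProduct_mulVec]
  rfl

/-- The `(Δ_ND)⁻¹` automaton.  [cite: KazeevKhoromskij2012, Thm. 4.1] -/
theorem vecMul_chainProd_ndInvCore (d : ℕ) (σ μ : Fin d → Fin 2) :
    ![(1 : K), 0, 0, 0] ᵥ* TensorTrain.chainProd (fun _ => ndInvCore K) d (fun r => (σ r, μ r)) =
      ndInvVec K d (quanticsEquiv 2 d σ) (quanticsEquiv 2 d μ) := by
  have h0 : ndInvVec K 0 0 0 = ![1, 0, 0, 0] := by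
    ext j; fin_cases j <;> simp [ndInvVec]
  rw [← h0]
  exact TensorTrain.vecMul_chainProd_of_digitStep (ndInvCore K) (ndInvVec K)
    (fun k m m' a a' _ _ => ndInvVec_step k m m' a a') d σ μ

/-- [folklore] Output of the `(Δ_ND)⁻¹` automaton (bookkeeping case analysis). -/
private theorem ndInvVec_dotProduct (k m n : ℕ) :
    ndInvVec K k m n ⬝ᵥ ![1, 1, 1, 1] = (2 : K) ^ k - ((max m n : ℕ) : K) := by
  simp [ndInvVec, dotProduct, Fin.sum_univ_four, max_def]
  split_ifs <;> first | (exfalso; omega) | ring1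

/-- THEOREM 4.1 (the `Δ_ND` line): `(Δ_ND^{(d)})⁻¹` has QTT ranks `4` — the uniform train with
cores `[I I₁ J J'; 0 2E 0 0; 0 I₁+J' E 0; 0 I₁+J 0 E]` and boundary vectors `(1, 0, 0, 0)`,
`(1, 1, 1, 1)` represents `(N - max(m, n))_{m,n}`, `N = 2^d` …
[cite: KazeevKhoromskij2012, Thm. 4.1] -/
theorem qttMatrix_ndInvTrain (d : ℕ) : (ndInvTrain K d).qttMatrix = greenND K (2 ^ d) := by
  rw [TensorTrain.qttMatrix_eq_iff]
  intro σ μ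
  rw [ndInvTrain, TensorTrain.eval_uniform, vecMul_chainProd_ndInvCore, greenND, Matrix.of_apply,
    ndInvVec_dotProduct]
  push_cast
  ring

/-- … which is `(Δ_ND^{(d)})⁻¹` (Prop. 3.1).  [cite: KazeevKhoromskij2012, Thm. 4.1] -/
theorem qttMatrix_ndInvTrain_eq_inv (d : ℕ) :
    (ndInvTrain K d).qttMatrix = (laplaceND K (2 ^ d))⁻¹ := by
  rw [qttMatrix_ndInvTrain, inv_laplaceND]

/-- … so that `Δ_ND^{(d)} · (the represented matrix) = I`.
[cite: KazeevKhoromskij2012, Thm. 4.1] -/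
theorem laplaceND_mul_qttMatrix_ndInvTrain (d : ℕ) :
    laplaceND K (2 ^ d) * (ndInvTrain K d).qttMatrix = 1 := by
  rw [qttMatrix_ndInvTrain, laplaceND_mul_greenND]

end KazeevKhoromskijInverse

/-! ### Lemma 3.3: `(Δ_DD)⁻¹` has QTT ranks five -/

section KazeevKhoromskijInverseDD

variable (K : Type u) [Field K]

/-- The `2 × 2` block `P = [0 1; 1 0]` of eq. (7), as a function of (row digit, column digit).
[cite: KazeevKhoromskij2012, eq. (7)] -/
def blkP (p : Fin 2 × Fin 2) : K := if p.1 = p.2 then 0 else 1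

/-- The `2 × 2` block `F = [1 -1; -1 1]` of eq. (7).  [cite: KazeevKhoromskij2012, eq. (7)] -/
def blkF (p : Fin 2 × Fin 2) : K := if p.1 = p.2 then 1 else -1

/-- The `2 × 2` block `K = [-1 0; 0 1] = I₂ - I₁` of eq. (7).
[cite: KazeevKhoromskij2012, eq. (7)] -/
def blkK (p : Fin 2 × Fin 2) : K := blkI₂ K p - blkI₁ K p

/-- The `2 × 2` block `L = [0 -1; 1 0] = J' - J` of eq. (7).
[cite: KazeevKhoromskij2012, eq. (7)] -/
def blkL (p : Fin 2 × Fin 2) : K := blkJ' K p - blkJ K p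

/-- `ξ_k = (2^{k-1} + 1)/(2^k + 1)`, written as a function of `q = 2^k`: `(q + 2)/(2(q + 1))`.
[cite: KazeevKhoromskij2012, Lem. 3.3] -/
def ddXi (q : K) : K := (q + 2) / (2 * (q + 1))

/-- `η_k = 2^{k-2}/(2^k + 1)`, as a function of `q = 2^k`: `q/(4(q + 1))`.
[cite: KazeevKhoromskij2012, Lem. 3.3] -/
def ddEta (q : K) : K := q / (4 * (q + 1))

/-- `ζ_k = (2^{k-1} + 1)/2^{k-1} · ξ_k`, as a function of `q = 2^k`: `(q + 2)²/(2q(q + 1))`.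
[cite: KazeevKhoromskij2012, Lem. 3.3] -/
def ddZeta (q : K) : K := (q + 2) ^ 2 / (2 * q * (q + 1))

/-- The rank-`5` core `C_k = [I Γ_k; 0 V_k]` (`q = 2^k`) of the QTT representation of
`(Δ_DD^{(d)})⁻¹`: `Γ_k = [¼ξ_k I + ¼ζ_k P,  ξ_k I - ζ_k P,  -½ξ_k K,  ½ζ_k L]`,
`V_k = [2E 0 0 0; 2η_k² F, 2ξ_k² E, 2ξ_kη_k K, 2ξ_kη_k L; 4η_k K, 0, 2ξ_k E, 0;
-4η_k L, 0, 0, 2ξ_k E]`.  The middle cores of Lem. 3.3 are `W_k = C_k` (`2 ≤ k ≤ d - 1`), the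
first is `W_d = [I Γ_d] = e₀ᵀ ⋈ C_d` and the last is `W_1 = C_1 ⋈ (½, 1, 0, 0, 0)ᵀ`
(`ddInvCore_two_mulVec`).  CAVEAT (see the file header): the factors `½`, `½` in `Γ_k` and the
factor `2` in the `L`-entry of `V_k` differ from the display printed in Preprint 75/2010, which
has `-ξ_k K`, `ζ_k L`, `ξ_kη_k L` there; with the printed factors the product is not
`(Δ_DD^{(d)})⁻¹` for `d ≥ 2`.  [cite: KazeevKhoromskij2012, Lem. 3.3] -/
def ddInvCore (q : K) (p : Fin 2 × Fin 2) : Matrix (Fin 5) (Fin 5) K :=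
  !![blkI K p, ddXi K q / 4 * blkI K p + ddZeta K q / 4 * blkP K p,
      ddXi K q * blkI K p - ddZeta K q * blkP K p, -(ddXi K q / 2) * blkK K p,
      ddZeta K q / 2 * blkL K p;
    0, 2, 0, 0, 0;
    0, 2 * ddEta K q ^ 2 * blkF K p, 2 * ddXi K q ^ 2, 2 * ddXi K q * ddEta K q * blkK K p,
      2 * ddXi K q * ddEta K q * blkL K p;
    0, 4 * ddEta K q * blkK K p, 0, 2 * ddXi K q, 0;
    0, -(4 * ddEta K q) * blkL K p, 0, 0, 2 * ddXi K q]

/-- The rank-`5` train of Lem. 3.3 in uniform (position-dependent) form: the core at position `ℓ`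
(from the left, `0 ≤ ℓ < d`) is `C_{d-ℓ}`, the boundary vectors are `e₀ = (1, 0, 0, 0, 0)` and
`H_0 = (½, 1, 0, 0, 0)`.  [cite: KazeevKhoromskij2012, Lem. 3.3] -/
def ddInvTrain (d : ℕ) : TensorTrain K (Fin 2 × Fin 2) d :=
  TensorTrain.uniform d 5 (fun ℓ => ddInvCore K ((2 : K) ^ (d - ℓ))) ![1, 0, 0, 0, 0]
    ![1 / 2, 1, 0, 0, 0]

/-- `z_m = q(2m + 1 - q)/(2(q + 1))` (`q = 2^k`): the centred first moment carried by the column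
states (proof of Lem. 3.3, eqs. (17)–(20)).  [cite: KazeevKhoromskij2012, Lem. 3.3] -/
def ddZ (q : K) (m : ℕ) : K := q * (2 * (m : K) + 1 - q) / (2 * (q + 1))

/-- `G(m, n) = (min(m,n) + 1)(q - max(m,n))/(q + 1) = (Δ_DD^{(k)})⁻¹(m, n)` (`q = 2^k`, Prop. 3.1).
[cite: KazeevKhoromskij2012, Prop. 3.1] -/
def ddG (q : K) (m n : ℕ) : K := (((min m n : ℕ) : K) + 1) * (q - ((max m n : ℕ) : K)) / (q + 1)

/-- Column states of the `(Δ_DD)⁻¹` representation after the `k` trailing cores: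
`H_k(m, n) = C_k ⋯ C_1 H_0 = (G(m,n), 2^k, z_m z_n / 2^k, z_m + z_n, z_n - z_m)` (`q = 2^k`; cf. the
vectors `Δ⁻¹, 2^k E, X X', X + X', X' - X` spanning the recursion (17)–(20)).
[cite: KazeevKhoromskij2012, Lem. 3.3] -/
def ddInvVec (k m n : ℕ) : Fin 5 → K :=
  ![ddG K (2 ^ k) m n, (2 : K) ^ k, ddZ K (2 ^ k) m * ddZ K (2 ^ k) n / 2 ^ k,
    ddZ K (2 ^ k) m + ddZ K (2 ^ k) n, ddZ K (2 ^ k) n - ddZ K (2 ^ k) m]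

/-- The first core `W_d = [I Γ_d]` of Lem. 3.3 (a `1 × 5` core matrix; `q = 2^d`).
[cite: KazeevKhoromskij2012, Lem. 3.3] -/
def ddInvFirst (q : K) (p : Fin 2 × Fin 2) : Matrix (Fin 1) (Fin 5) K :=
  !![blkI K p, ddXi K q / 4 * blkI K p + ddZeta K q / 4 * blkP K p,
      ddXi K q * blkI K p - ddZeta K q * blkP K p, -(ddXi K q / 2) * blkK K p,
      ddZeta K q / 2 * blkL K p]

/-- The last core `W_1 = [⅓(I + E); 2E; F/18; ⅔K; -⅔L]` of Lem. 3.3 (a `5 × 1` core matrix;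
`E = I + P`, so `⅓(I + E)` has entries `(blkI + 1)/3`).  [cite: KazeevKhoromskij2012, Lem. 3.3] -/
def ddInvLast (p : Fin 2 × Fin 2) : Matrix (Fin 5) (Fin 1) K :=
  !![(blkI K p + 1) / 3; 2; blkF K p / 18; 2 / 3 * blkK K p; -(2 / 3) * blkL K p]

variable {K}

/-- `W_d = [I Γ_d]` VERBATIM: the first core of Lem. 3.3 is the first row `e₀ᵀ ⋈ C_d` of `C_d`.
[cite: KazeevKhoromskij2012, Lem. 3.3] -/
theorem vecMul_ddInvCore (q : K) (p : Fin 2 × Fin 2) :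
    ![(1 : K), 0, 0, 0, 0] ᵥ* ddInvCore K q p =
      ![blkI K p, ddXi K q / 4 * blkI K p + ddZeta K q / 4 * blkP K p,
        ddXi K q * blkI K p - ddZeta K q * blkP K p, -(ddXi K q / 2) * blkK K p,
        ddZeta K q / 2 * blkL K p] := by
  ext j
  fin_cases j <;> simp [ddInvCore, Matrix.vecMul, dotProduct, Fin.sum_univ_five]

/-- [folklore] The first core of Lem. 3.3 is `e₀ᵀ ⋈ C_d` (bookkeeping). -/
private theorem ddInvFirst_eq (q : K) (p : Fin 2 × Fin 2) :
    ddInvFirst K q p =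
      Matrix.of fun (_ : Fin 1) j => (![(1 : K), 0, 0, 0, 0] ᵥ* ddInvCore K q p) j := by
  rw [vecMul_ddInvCore]
  ext i j
  fin_cases i; fin_cases j <;> rfl

variable [CharZero K]

/-- `W_1 = [⅓(I + E); 2E; F/18; ⅔K; -⅔L]` VERBATIM: the last core of Lem. 3.3 is `C_1 ⋈ H_0`,
`H_0 = (½, 1, 0, 0, 0)ᵀ` (here `q = 2^1 = 2`, `ξ_1 = ⅔`, `η_1 = ⅙`, `ζ_1 = 4/3`; `E = I + P`).
[cite: KazeevKhoromskij2012, Lem. 3.3] -/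
theorem ddInvCore_two_mulVec (p : Fin 2 × Fin 2) :
    ddInvCore K 2 p *ᵥ ![1 / 2, 1, 0, 0, 0] =
      ![(blkI K p + 1) / 3, 2, blkF K p / 18, 2 / 3 * blkK K p, -(2 / 3) * blkL K p] := by
  obtain ⟨a, a'⟩ := p
  ext j
  fin_cases a <;> fin_cases a' <;> fin_cases j <;>
    simp [ddInvCore, ddXi, ddEta, ddZeta, blkI, blkP, blkF, blkK, blkL, blkI₁, blkI₂, blkJ, blkJ',
      Matrix.mulVec, dotProduct, Fin.sum_univ_five] <;> norm_num

/-- [folklore] One step of the `(Δ_DD)⁻¹` column-state recursion, digit pair `(0, 0)`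
(bookkeeping: rational identities checked by `field_simp`/`ring`). -/
private theorem ddInvVec_step₀₀ (k m n : ℕ) :
    ddInvVec K (k + 1) (m) (n) =
      ddInvCore K ((2 : K) ^ (k + 1)) (0, 0) *ᵥ ddInvVec K k m n := by
  have hq : (2 : K) ^ k + 1 ≠ 0 := by exact_mod_cast (show (2 ^ k + 1 : ℕ) ≠ 0 by positivity)
  have hQ : (2 : K) ^ k * 2 + 1 ≠ 0 := by
    exact_mod_cast (show (2 ^ k * 2 + 1 : ℕ) ≠ 0 by positivity)
  have hq0 : (2 : K) ^ k ≠ 0 := pow_ne_zero _ two_ne_zero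
  ext j
  rcases le_total m n with hmn | hmn <;> fin_cases j <;>
    simp [ddInvVec, ddInvCore, ddXi, ddEta, ddZeta, ddG, ddZ, blkI, blkP, blkF, blkK, blkL,
      blkI₁, blkI₂, blkJ, blkJ', Matrix.mulVec, dotProduct, Fin.sum_univ_five, pow_succ, hmn] <;>
    (set q : K := (2 : K) ^ k with hq_def) <;>
    field_simp <;> ring1

/-- [folklore] One step of the `(Δ_DD)⁻¹` column-state recursion, digit pair `(0, 1)`
(bookkeeping: rational identities checked by `field_simp`/`ring`). -/
private theorem ddInvVec_step₀₁ (k m n : ℕ) (hm : m < 2 ^ k) :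
    ddInvVec K (k + 1) (m) (2 ^ k + n) =
      ddInvCore K ((2 : K) ^ (k + 1)) (0, 1) *ᵥ ddInvVec K k m n := by
  have hq : (2 : K) ^ k + 1 ≠ 0 := by exact_mod_cast (show (2 ^ k + 1 : ℕ) ≠ 0 by positivity)
  have hQ : (2 : K) ^ k * 2 + 1 ≠ 0 := by
    exact_mod_cast (show (2 ^ k * 2 + 1 : ℕ) ≠ 0 by positivity)
  have hq0 : (2 : K) ^ k ≠ 0 := pow_ne_zero _ two_ne_zero
  have h1 : min m (2 ^ k + n) = m := min_eq_left (by omega)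
  have h2 : max m (2 ^ k + n) = 2 ^ k + n := max_eq_right (by omega)
  ext j
  fin_cases j <;>
    simp [ddInvVec, ddInvCore, ddXi, ddEta, ddZeta, ddG, ddZ, blkI, blkP, blkF, blkK, blkL,
      blkI₁, blkI₂, blkJ, blkJ', Matrix.mulVec, dotProduct, Fin.sum_univ_five, pow_succ, h1, h2] <;>
    (set q : K := (2 : K) ^ k with hq_def) <;>
    field_simp <;> ring1

/-- [folklore] One step of the `(Δ_DD)⁻¹` column-state recursion, digit pair `(1, 0)`
(bookkeeping: rational identities checked by `field_simp`/`ring`). -/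
private theorem ddInvVec_step₁₀ (k m n : ℕ) (hn : n < 2 ^ k) :
    ddInvVec K (k + 1) (2 ^ k + m) (n) =
      ddInvCore K ((2 : K) ^ (k + 1)) (1, 0) *ᵥ ddInvVec K k m n := by
  have hq : (2 : K) ^ k + 1 ≠ 0 := by exact_mod_cast (show (2 ^ k + 1 : ℕ) ≠ 0 by positivity)
  have hQ : (2 : K) ^ k * 2 + 1 ≠ 0 := by
    exact_mod_cast (show (2 ^ k * 2 + 1 : ℕ) ≠ 0 by positivity)
  have hq0 : (2 : K) ^ k ≠ 0 := pow_ne_zero _ two_ne_zero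
  have h3 : min (2 ^ k + m) n = n := min_eq_right (by omega)
  have h4 : max (2 ^ k + m) n = 2 ^ k + m := max_eq_left (by omega)
  ext j
  fin_cases j <;>
    simp [ddInvVec, ddInvCore, ddXi, ddEta, ddZeta, ddG, ddZ, blkI, blkP, blkF, blkK, blkL,
      blkI₁, blkI₂, blkJ, blkJ', Matrix.mulVec, dotProduct, Fin.sum_univ_five, pow_succ, h3, h4] <;>
    (set q : K := (2 : K) ^ k with hq_def) <;>
    field_simp <;> ring1

/-- [folklore] One step of the `(Δ_DD)⁻¹` column-state recursion, digit pair `(1, 1)`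
(bookkeeping: rational identities checked by `field_simp`/`ring`). -/
private theorem ddInvVec_step₁₁ (k m n : ℕ) :
    ddInvVec K (k + 1) (2 ^ k + m) (2 ^ k + n) =
      ddInvCore K ((2 : K) ^ (k + 1)) (1, 1) *ᵥ ddInvVec K k m n := by
  have hq : (2 : K) ^ k + 1 ≠ 0 := by exact_mod_cast (show (2 ^ k + 1 : ℕ) ≠ 0 by positivity)
  have hQ : (2 : K) ^ k * 2 + 1 ≠ 0 := by
    exact_mod_cast (show (2 ^ k * 2 + 1 : ℕ) ≠ 0 by positivity)
  have hq0 : (2 : K) ^ k ≠ 0 := pow_ne_zero _ two_ne_zero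
  ext j
  rcases le_total m n with hmn | hmn <;> fin_cases j <;>
    simp [ddInvVec, ddInvCore, ddXi, ddEta, ddZeta, ddG, ddZ, blkI, blkP, blkF, blkK, blkL,
      blkI₁, blkI₂, blkJ, blkJ', Matrix.mulVec, dotProduct, Fin.sum_univ_five, pow_succ, hmn] <;>
    (set q : K := (2 : K) ^ k with hq_def) <;>
    field_simp <;> ring1


/-- [folklore] One step of the `(Δ_DD)⁻¹` column-state recursion (the four digit pairs combined). -/
private theorem ddInvVec_step (k m n : ℕ) (a a' : Fin 2) (hm : m < 2 ^ k) (hn : n < 2 ^ k) :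
    ddInvVec K (k + 1) (a * 2 ^ k + m) (a' * 2 ^ k + n) =
      ddInvCore K ((2 : K) ^ (k + 1)) (a, a') *ᵥ ddInvVec K k m n := by
  fin_cases a <;> fin_cases a'
  · simpa using ddInvVec_step₀₀ k m n
  · simpa using ddInvVec_step₀₁ k m n hm
  · simpa using ddInvVec_step₁₀ k m n hn
  · simpa using ddInvVec_step₁₁ k m n

/-- `H_0 = (½, 1, 0, 0, 0)`: the column state before any core is read (`q = 2^0 = 1`,
`G(0, 0) = ½ = (Δ_DD^{(0)})⁻¹`, `z_0 = 0`).  [cite: KazeevKhoromskij2012, Lem. 3.3] -/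
theorem ddInvVec_zero : ddInvVec K 0 0 0 = ![1 / 2, 1, 0, 0, 0] := by
  ext j
  fin_cases j <;> norm_num [ddInvVec, ddG, ddZ]

/-- The column-state recursion of Lem. 3.3: `C_d(σ₀, μ₀) ⋯ C_1(σ_{d-1}, μ_{d-1}) H_0 = H_d(m, n)`
for `m = m(σ)`, `n = m(μ)` (most significant digit first).
[cite: KazeevKhoromskij2012, Lem. 3.3] -/
theorem chainProd_ddInvCore_mulVec (d : ℕ) (σ μ : Fin d → Fin 2) :
    TensorTrain.chainProd (fun ℓ => ddInvCore K ((2 : K) ^ (d - ℓ))) d (fun r => (σ r, μ r)) *ᵥ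
        ![1 / 2, 1, 0, 0, 0] =
      ddInvVec K d (quanticsEquiv 2 d σ) (quanticsEquiv 2 d μ) := by
  rw [← ddInvVec_zero]
  exact TensorTrain.mulVec_chainProd_of_digitStepCons (fun k => ddInvCore K ((2 : K) ^ k))
    (ddInvVec K) (fun k m m' a a' hm hm' => ddInvVec_step k m m' a a' hm hm') d σ μ

/-- PROPOSITION 3.1 (`Δ_DD`, inverse form over a field of characteristic zero):
`(Δ_DD^{(N)})⁻¹ = (N + 1)⁻¹ · ((min(m,n) + 1)(N - max(m,n)))_{m,n}`.
[cite: KazeevKhoromskij2012, Prop. 3.1] -/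
theorem inv_laplaceDD (N : ℕ) : (laplaceDD K N)⁻¹ = ((N : K) + 1)⁻¹ • greenDD K N := by
  have hN : (N : K) + 1 ≠ 0 := by exact_mod_cast (Nat.succ_ne_zero N)
  apply Matrix.inv_eq_right_inv
  rw [Matrix.mul_smul, laplaceDD_mul_greenDD, smul_smul, inv_mul_cancel₀ hN, one_smul]

/-- LEMMA 3.3: the rank-`5` train `e₀ᵀ ⋈ C_d ⋈ ⋯ ⋈ C_1 ⋈ H_0` represents
`(2^d + 1)⁻¹ · ((min(m,n) + 1)(2^d - max(m,n)))_{m,n}` …  [cite: KazeevKhoromskij2012, Lem. 3.3] -/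
theorem qttMatrix_ddInvTrain (d : ℕ) :
    (ddInvTrain K d).qttMatrix = ((2 : K) ^ d + 1)⁻¹ • greenDD K (2 ^ d) := by
  rw [TensorTrain.qttMatrix_eq_iff]
  intro σ μ
  rw [ddInvTrain, TensorTrain.eval_uniform, ← Matrix.dotProduct_mulVec, chainProd_ddInvCore_mulVec]
  simp [ddInvVec, ddG, greenDD, div_eq_inv_mul]

/-- … which is `(Δ_DD^{(d)})⁻¹` (Prop. 3.1): `(Δ_DD^{(d)})⁻¹` has QTT ranks `≤ 5`.
[cite: KazeevKhoromskij2012, Lem. 3.3] -/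
theorem qttMatrix_ddInvTrain_eq_inv (d : ℕ) :
    (ddInvTrain K d).qttMatrix = (laplaceDD K (2 ^ d))⁻¹ := by
  rw [qttMatrix_ddInvTrain, inv_laplaceDD]
  push_cast
  rfl

/-- … so that `Δ_DD^{(d)} · (the represented matrix) = I`.
[cite: KazeevKhoromskij2012, Lem. 3.3] -/
theorem laplaceDD_mul_qttMatrix_ddInvTrain (d : ℕ) :
    laplaceDD K (2 ^ d) * (ddInvTrain K d).qttMatrix = 1 := by
  have h : (2 : K) ^ d + 1 ≠ 0 := by exact_mod_cast (show (2 ^ d + 1 : ℕ) ≠ 0 by positivity)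
  rw [qttMatrix_ddInvTrain, Matrix.mul_smul, laplaceDD_mul_greenDD, smul_smul, Nat.cast_pow,
    Nat.cast_ofNat, inv_mul_cancel₀ h, one_smul]

/-- [folklore] The last core of Lem. 3.3 is `C_1 ⋈ H_0` (bookkeeping). -/
private theorem ddInvLast_eq (p : Fin 2 × Fin 2) :
    ddInvLast K p = Matrix.of fun i (_ : Fin 1) => (ddInvCore K 2 p *ᵥ ![1 / 2, 1, 0, 0, 0]) i := by
  rw [ddInvCore_two_mulVec]
  ext i j
  fin_cases j; fin_cases i <;> rfl

/-- LEMMA 3.3 VERBATIM (`d = k + 2 ≥ 2`): with the row/column digit pairs `(i₁, j₁), …, (i_d, j_d)`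
of `(m, n)` (most significant first), the unique entry of the `1 × 1` matrix
`W_d(i₁,j₁) · W_{d-1}(i₂,j₂) ⋯ W_2(i_{d-1},j_{d-1}) · W_1(i_d,j_d)` — the `((i₁…i_d), (j₁…j_d))`
block entry of `W_d ⋈ W_{d-1} ⋈ ⋯ ⋈ W_2 ⋈ W_1`, `W_k = C_k` for `2 ≤ k ≤ d - 1` — is
`(Δ_DD^{(d)})⁻¹(m, n)` (with the corrected factors, see `ddInvCore`).
[cite: KazeevKhoromskij2012, Lem. 3.3] -/
theorem inv_laplaceDD_eq_ddInvFirst_mul_chainProd_mul_ddInvLast (k : ℕ)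
    (σ μ : Fin (k + 2) → Fin 2) :
    (ddInvFirst K ((2 : K) ^ (k + 2)) (σ 0, μ 0) *
        TensorTrain.chainProd (fun ℓ => ddInvCore K ((2 : K) ^ (k + 1 - ℓ))) k
          (fun r : Fin k => (σ r.succ.castSucc, μ r.succ.castSucc)) *
        ddInvLast K (σ (Fin.last (k + 1)), μ (Fin.last (k + 1)))) 0 0 =
      (laplaceDD K (2 ^ (k + 2)))⁻¹ (quanticsEquiv 2 (k + 2) σ) (quanticsEquiv 2 (k + 2) μ) := by
  have hW : (fun i => ddInvCore K ((2 : K) ^ (k + 2 - (i + 1)))) =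
      fun i => ddInvCore K ((2 : K) ^ (k + 1 - i)) := by
    funext i
    congr 2
    omega
  have hlast : k + 2 - (k + 1) = 1 := by omega
  rw [← qttMatrix_ddInvTrain_eq_inv, TensorTrain.qttMatrix_apply, ddInvTrain,
    TensorTrain.eval_uniform, TensorTrain.chainProd, TensorTrain.chainProd_succ_eq_core_mul]
  simp only [hW, hlast, pow_one, Nat.sub_zero]
  rw [ddInvFirst_eq, ddInvLast_eq, row_mul_mul_col_apply']
  simp only [← Matrix.vecMul_vecMul, Matrix.dotProduct_mulVec]
  rfl

end KazeevKhoromskijInverseDD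

end Literature.LinearAlgebra.TensorNetworks
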